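import Summits.QuantumFields.BalabanUV.T4Continuum.Support.NE7K1LinHomGramBond
import Summits.QuantumFields.BalabanUV.T4Continuum.Support.NE7K1LinHomLipschitz

/-!
# NE7K1LinHomGramUpper — row NE7 (node U5), candidate route HOM, path H1L, cell K1-lin(s): THE L-UNIFORM UPPER TWO-RUN COMPARISON ON
# BOXES WITH THE GRAM CONSTANT — `⟨V, P_B^{Schur}V⟩ ≤ 3·(37∕30)^d·⟨V, P_A V⟩` (= 3, 3.70, 4.56, 5.63 for `d+1 = 1…4`)

Lineage `b2b-balaban-t4-ne7-p2` (CRUX PROVER NE7 #2), generation 66 (eleventh and closing file; Gram sharpening of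
`NE7K1LinHomUpper.schurB_form_le_hom`, whose constant was the Schur-test product `5·(5∕2)^d` = 5, 12.5, 31.25, 78.125).  The lift and
its Abel-summed increment are those of `NE7K1LinHomLift`; what changes is the estimate of `Σ_x (Σ_Y g_Y c_ν(x,Y))²`: expand the
square, `M(Y,Z) = Σ_x c_ν(x,Y)c_ν(x,Z)` factorises into one-dimensional GRAM entries (`sum_bondK_mul_bondK`: transverse factors
`NE7K1LinHomGramKernel.gramK`, bond factor `NE7K1LinHomGramBond.gramB`), `Σ_{Y,Z} g_Y g_Z M(Y,Z) ≤ (max_Y Σ_Z|M(Y,Z)|)·Σ g²` for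
symmetric `M` (`sum_mul_mul_le_of_symm`), and the row sums are `≤ (37∕30)L` per transverse direction (`gramK_row_abs`) and `≤ 3∕L`
for the bond factor (`gramB_row_abs`).  In one dimension the constant is `3` — the sharp L-uniform value (lens 2's number
`ρ(L) = 3L²∕(L²+2) ↑ 3`, t4-ne7-idea-2 g35).  All [folklore]:

* **`energy_dir_le_gram`**: `L²·Σ_{fine ν-bonds}(Φ(x+e_ν) − Φ x)² ≤ 3·(37∕30)^d·L^{d+1}·Σ_{coarse ν-bonds}(V(Y) − V(Y+e_ν))²`.
* **`schurB_form_le_gram`**: `a > 0`, `n ≥ 1`, `L ≥ 1`, `hbox : R′ = boxDom (n·L·M)` ⇒ `⟨V, twoCutoffLine … 1 V⟩ ≤ 3·(37∕30)^d·⟨V, runA V⟩`;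
  with `NE7K1LinTwoRunJensen.runA_form_le_schurB_sharp`: **`P_A ⪯ P_B^{Schur} ⪯ 3·(37∕30)^d·P_A` on boxes, uniformly in `L`**.
* **`twoCutoff_inv_lipschitz_gram`**: `‖(G(s) − G(t))g‖² ≤ (t−s)²((3·(37∕30)^d − 1)∕min(2,a))²‖g‖²` on boxes, every `L`.

HONEST FRAMING: Gaussian `A = 0`, finite boxes, finite real matrices, [folklore]; ONE RG step in `U = 1` gauge; a census ∕
NEEDS-CONSTANT sharpening of the L-uniform upper two-run constant of `NE7K1LinHomUpper` (`5·(5∕2)^d ↦ 3·(37∕30)^d`), no letter ∕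
tag ∕ size of NE7 moves; nothing printed asserted; no `sorry`.  FIXED FINITE T⁴, rung (B)+1; NE7 NOT PRINTED ∕ NOT PROVED; spine 0∕9;
NOT infinite volume, NOT mass gap, NOT Clay.  HONEST DEPENDENCY: continuum YM on T⁴ ⇐ BetaPertH ∧ nine spine estimates (0/9 proved);
BetaPertH ⇐ (D1) ∧ (D4) ∧ CAP+tail; G-an2-4 gates asym, D1 and NE2/3/4.
-/

noncomputable section

open Finset Matrix

namespace Summit.QuantumFields.BalabanUV.T4Continuum.NE7K1LinHomGramUpper

open Literature.MathematicalPhysics.QuantumFieldTheory.Balaban1983to89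
open Literature.MathematicalPhysics.QuantumFieldTheory.Balaban1983to89.B4Reflection242
open Literature.MathematicalPhysics.QuantumFieldTheory.Balaban1983to89.B4BoxCov237
open Literature.MathematicalPhysics.QuantumFieldTheory.Balaban1983to89.B4Lower18
open Literature.MathematicalPhysics.QuantumFieldTheory.Balaban1983to89.B4Green244 (finePt)
open NE7K1LinHomKernel NE7K1LinHomKernelSums NE7K1LinHomKernelBond NE7K1LinHomLift NE7K1LinHomUpper NE7K1LinHomGramSums
  NE7K1LinHomGramKernel NE7K1LinHomGramBond

variable {d : ℕ}

/-! ### §3 The Gram form of the directional energy: second-order (Gram) information in the transverse kernels -/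

section GramEnergy

variable {N : Fin (d + 1) → ℕ} {L : ℕ}

/-- the bond Gram entry over the fine bonds `Ico 0 (NL − 1)` equals the `range (NL)` sum (the last site carries no bond). [folklore] -/
theorem gramB_eq_Ico (Nn L : ℕ) (Y Z : ℤ) :
    ∑ s ∈ Finset.Ico (0 : ℤ) ((Nn * L : ℕ) - 1), bondF Nn L s Y * bondF Nn L s Z = gramB Nn L Y Z := by
  unfold gramB
  rcases Nat.eq_zero_or_pos (Nn * L) with h0 | hpos
  · rw [h0]; simp
  · have e : (((Nn * L : ℕ) : ℤ)) - 1 = ((Nn * L - 1 : ℕ) : ℤ) := by omega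
    rw [e, sum_Ico_eq_sum_range, sum_range_split_last hpos (fun t => bondF Nn L (t : ℤ) Y * bondF Nn L (t : ℤ) Z),
      bondF_of_not_mem (N := Nn) (L := L) (t := ((Nn * L - 1 : ℕ) : ℤ)) (by omega) Y, zero_mul, add_zero]

/-- the mixed Gram entry of the bond kernel `c_ν`: `M(Y,Z) = Σ_{fine ν-bonds x} c_ν(x,Y)c_ν(x,Z)`, a product of one-dimensional Gram
entries. [folklore] -/
theorem sum_bondK_mul_bondK (ν : Fin (d + 1)) (Y Z : Fin (d + 1) → ℤ) :
    ∑ x ∈ (fineBox N L).filter (fun x => x + uvec ν ∈ fineBox N L), bondK N L ν x Y * bondK N L ν x Z =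
      ∏ μ, (if μ = ν then gramB (N μ) L (Y μ) (Z μ) else gramK (N μ) L (Y μ) (Z μ)) := by
  rw [filter_fineBox_eq]
  have h : ∀ x : Fin (d + 1) → ℤ, bondK N L ν x Y * bondK N L ν x Z =
      ∏ μ, ((if μ = ν then bondF (N μ) L (x μ) (Y μ) else kerF (N μ) L (x μ) (Y μ)) *
        (if μ = ν then bondF (N μ) L (x μ) (Z μ) else kerF (N μ) L (x μ) (Z μ))) := fun x => by
    unfold bondK; rw [← Finset.prod_mul_distrib]
  simp_rw [h]
  rw [← Finset.prod_univ_sum (fun μ => if μ = ν then Finset.Ico (0 : ℤ) ((N μ * L : ℕ) - 1) else Finset.Ico (0 : ℤ) (N μ * L : ℕ))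
    (fun μ s => (if μ = ν then bondF (N μ) L s (Y μ) else kerF (N μ) L s (Y μ)) *
      (if μ = ν then bondF (N μ) L s (Z μ) else kerF (N μ) L s (Z μ)))]
  refine Finset.prod_congr rfl fun μ _ => ?_
  by_cases hμ : μ = ν
  · subst hμ; simp only [if_true]; exact gramB_eq_Ico _ _ _ _
  · simp only [hμ, if_false]; unfold gramK; rw [sum_Ico_eq_sum_range]

/-- symmetric weighted sums: `Σ_{Y,Z} g_Y g_Z M(Y,Z) ≤ (max row absolute sum of M)·Σ g_Y²` for a symmetric `M`. [folklore] -/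
theorem sum_mul_mul_le_of_symm {ι : Type*} (S : Finset ι) (g : ι → ℝ) (M : ι → ι → ℝ) (hM : ∀ Y Z, M Y Z = M Z Y)
    {m : ℝ} (hm : ∀ Y ∈ S, ∑ Z ∈ S, |M Y Z| ≤ m) :
    ∑ Y ∈ S, ∑ Z ∈ S, g Y * g Z * M Y Z ≤ m * ∑ Y ∈ S, g Y ^ 2 := by
  have h1 : ∑ Y ∈ S, ∑ Z ∈ S, g Y * g Z * M Y Z ≤ ∑ Y ∈ S, ∑ Z ∈ S, (g Y ^ 2 / 2 + g Z ^ 2 / 2) * |M Y Z| := by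
    refine Finset.sum_le_sum fun Y _ => Finset.sum_le_sum fun Z _ => ?_
    have h := two_mul_le_add_sq (|g Y|) (|g Z|)
    rw [sq_abs, sq_abs] at h
    calc g Y * g Z * M Y Z ≤ |g Y * g Z * M Y Z| := le_abs_self _
      _ = |g Y| * |g Z| * |M Y Z| := by rw [abs_mul, abs_mul]
      _ ≤ (g Y ^ 2 / 2 + g Z ^ 2 / 2) * |M Y Z| := mul_le_mul_of_nonneg_right (by linarith) (abs_nonneg _)
  have h2 : ∑ Y ∈ S, ∑ Z ∈ S, (g Y ^ 2 / 2 + g Z ^ 2 / 2) * |M Y Z| = ∑ Y ∈ S, g Y ^ 2 * ∑ Z ∈ S, |M Y Z| := by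
    have e : ∑ Y ∈ S, ∑ Z ∈ S, g Z ^ 2 / 2 * |M Y Z| = ∑ Y ∈ S, ∑ Z ∈ S, g Y ^ 2 / 2 * |M Y Z| := by
      rw [Finset.sum_comm]; exact Finset.sum_congr rfl fun Y _ => Finset.sum_congr rfl fun Z _ => by rw [hM]
    simp_rw [add_mul, Finset.sum_add_distrib]
    rw [e, ← Finset.sum_add_distrib]
    refine Finset.sum_congr rfl fun Y _ => ?_
    rw [Finset.mul_sum, ← Finset.sum_add_distrib]
    exact Finset.sum_congr rfl fun Z _ => by ring
  rw [h2] at h1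
  refine h1.trans ?_
  rw [Finset.mul_sum]
  exact Finset.sum_le_sum fun Y hY => by rw [mul_comm]; exact mul_le_mul_of_nonneg_right (hm Y hY) (sq_nonneg _)

/-- **THE DIRECTIONAL ENERGY BOUND, GRAM FORM**: `L²·Σ_{fine ν-bonds}(Φ(x+e_ν) − Φ x)² ≤ 3·(37∕30)^d·L^{d+1}·Σ_{coarse ν-bonds}(ΔV)²`
— the transverse kernels enter through their GRAM row sums `37∕30·L` (`gramK_row_abs`) instead of the Schur product `(5∕2)L`,
the bond factor through `3∕L` (`gramB_row_abs`) instead of `5∕L`. [folklore] -/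
theorem energy_dir_le_gram (hL : 1 ≤ L) (ν : Fin (d + 1)) (V : (Fin (d + 1) → ℤ) → ℝ) :
    (L : ℝ) ^ 2 * ∑ x ∈ (fineBox N L).filter (fun x => x + uvec ν ∈ fineBox N L),
        (lift N L V (x + uvec ν) - lift N L V x) ^ 2 ≤
      3 * (37 / 30 : ℝ) ^ d * (L : ℝ) ^ (d + 1) *
        ∑ Y ∈ (boxDom N).filter (fun Y => Y + uvec ν ∈ boxDom N), (V Y - V (Y + uvec ν)) ^ 2 := by
  have hLr : (0 : ℝ) < L := by exact_mod_cast hL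
  set F := (fineBox N L).filter (fun x => x + uvec ν ∈ fineBox N L) with hF
  set S := (boxDom N).filter (fun Y => Y + uvec ν ∈ boxDom N) with hS
  set g : (Fin (d + 1) → ℤ) → ℝ := fun Y => V Y - V (Y + uvec ν) with hg
  set M : (Fin (d + 1) → ℤ) → (Fin (d + 1) → ℤ) → ℝ := fun Y Z => ∑ x ∈ F, bondK N L ν x Y * bondK N L ν x Z with hMdef
  -- expand the square
  have hexp : ∑ x ∈ F, (lift N L V (x + uvec ν) - lift N L V x) ^ 2 = ∑ Y ∈ S, ∑ Z ∈ S, g Y * g Z * M Y Z := by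
    have h : ∀ x ∈ F, (lift N L V (x + uvec ν) - lift N L V x) ^ 2 =
        ∑ Y ∈ S, ∑ Z ∈ S, g Y * g Z * (bondK N L ν x Y * bondK N L ν x Z) := by
      intro x hx
      rw [hF, Finset.mem_filter] at hx
      have hx0 : 0 ≤ x ν := ((mem_boxDom.1 hx.1) ν).1
      have hx1 : x ν + 1 < N ν * L := by
        have := (add_uvec_mem_boxDom ν hx.1).1 hx.2; push_cast at this; exact this
      rw [lift_succ_sub ν V hx0 hx1, ← hS, sq, Finset.sum_mul_sum]
      exact Finset.sum_congr rfl fun Y _ => Finset.sum_congr rfl fun Z _ => by rw [hg]; ring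
    rw [Finset.sum_congr rfl h, Finset.sum_comm]
    refine Finset.sum_congr rfl fun Y _ => ?_
    rw [Finset.sum_comm]
    refine Finset.sum_congr rfl fun Z _ => ?_
    rw [hMdef, Finset.mul_sum]
  -- the row bound of `M`
  have hM : ∀ Y Z, M Y Z = M Z Y := fun Y Z => Finset.sum_congr rfl fun x _ => mul_comm _ _
  have hrow : ∀ Y ∈ S, ∑ Z ∈ S, |M Y Z| ≤ 3 / (L : ℝ) * (37 / 30 * (L : ℝ)) ^ d := by
    intro Y hY
    have hYb : Y ∈ boxDom N := (Finset.mem_filter.1 hY).1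
    have hYμ : ∀ μ, 0 ≤ Y μ ∧ Y μ < N μ := fun μ => (mem_boxDom.1 hYb) μ
    calc ∑ Z ∈ S, |M Y Z| ≤ ∑ Z ∈ boxDom N, |M Y Z| :=
          Finset.sum_le_sum_of_subset_of_nonneg (Finset.filter_subset _ _) fun _ _ _ => abs_nonneg _
      _ = ∑ Z ∈ boxDom N, ∏ μ, |(if μ = ν then gramB (N μ) L (Y μ) (Z μ) else gramK (N μ) L (Y μ) (Z μ))| := by
          refine Finset.sum_congr rfl fun Z _ => ?_
          rw [hMdef]
          show |∑ x ∈ F, bondK N L ν x Y * bondK N L ν x Z| = _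
          rw [hF, sum_bondK_mul_bondK, Finset.abs_prod]
      _ = ∏ μ, ∑ z ∈ Finset.Ico (0 : ℤ) (N μ), |(if μ = ν then gramB (N μ) L (Y μ) z else gramK (N μ) L (Y μ) z)| := by
          rw [show boxDom N = Fintype.piFinset (fun μ => Finset.Ico (0 : ℤ) (N μ)) from rfl,
            ← Finset.prod_univ_sum (fun μ => Finset.Ico (0 : ℤ) (N μ))
              (fun μ z => |(if μ = ν then gramB (N μ) L (Y μ) z else gramK (N μ) L (Y μ) z)|)]
      _ ≤ ∏ μ : Fin (d + 1), (if μ = ν then 3 / (L : ℝ) else 37 / 30 * (L : ℝ)) := by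
          refine Finset.prod_le_prod (s := Finset.univ) (fun μ _ => Finset.sum_nonneg fun _ _ => abs_nonneg _) fun μ _ => ?_
          by_cases hμ : μ = ν
          · subst hμ
            simp only [if_true]
            rw [le_div_iff₀ hLr, mul_comm, sum_Ico_eq_sum_range]
            exact gramB_row_abs hL (hYμ μ).1 (hYμ μ).2
          · simp only [hμ, if_false]
            rw [sum_Ico_eq_sum_range]
            exact gramK_row_abs hL (hYμ μ).1 (hYμ μ).2
      _ = 3 / (L : ℝ) * (37 / 30 * (L : ℝ)) ^ d := prod_ite_eq_mul_pow ν _ _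
  have hmain := sum_mul_mul_le_of_symm S g M hM hrow
  rw [hexp]
  calc (L : ℝ) ^ 2 * ∑ Y ∈ S, ∑ Z ∈ S, g Y * g Z * M Y Z ≤ (L : ℝ) ^ 2 * (3 / (L : ℝ) * (37 / 30 * (L : ℝ)) ^ d * ∑ Y ∈ S, g Y ^ 2) :=
        mul_le_mul_of_nonneg_left hmain (by positivity)
    _ = 3 * (37 / 30 : ℝ) ^ d * (L : ℝ) ^ (d + 1) * ∑ Y ∈ S, g Y ^ 2 := by
        rw [mul_pow, pow_succ]; field_simp; ring

end GramEnergy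


/-! ### §4 The upper two-run comparison with the Gram constant `3·(37∕30)^d`, and its ∂_s letter -/

section Assembly

open NE7K1LinTwoRunFaces NE7K1LinSchurLineU1 NE7K1LinHomTrial NE7K1LinSchurLineForm NE7K1LinBlockCoords NE7K1LinTwoRunKit
  NE7K1LinTwoRunUpper NE7K1LinTwoRunLower NE7K1LinSchurLineDerivRel NE7K1LinSchurLineDerivU1 NE7K1LinTwoRunJensen
  NE7K1LinInvAntitone NE7K1LinTwoRunMonotone

variable {n L : ℕ} [NeZero L]

/-- **THE L-UNIFORM UPPER TWO-RUN COMPARISON ON BOXES WITH THE GRAM CONSTANT**: `⟨V,P_B^{Schur}V⟩ ≤ 3·(37∕30)^d·⟨V,P_A V⟩` for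
`a > 0`, `n ≥ 1`, `L ≥ 1`, `R′ = Π_μ[0, nLM_μ)` (= 3, 3.70, 4.56, 5.63 for `d + 1 = 1…4`; `NE7K1LinHomUpper.schurB_form_le_hom` had
`5·(5∕2)^d`). [folklore] -/
theorem schurB_form_le_gram (hn : 1 ≤ n) (M : Fin (d + 1) → ℕ) {R' : Finset (Fin (d + 1) → ℤ)}
    (hbox : R' = boxDom fun μ => n * L * M μ) (hR' : IsBlockUnion (n * L) R') {a : ℝ} (ha : 0 < a)
    (V : ↥(R'.image (blk L)) → ℝ) :
    V ⬝ᵥ (twoCutoffLine (isBlockUnion_fine hR') n a 1).mulVec V ≤ 3 * (37 / 30 : ℝ) ^ d * (V ⬝ᵥ (runA n L a R').mulVec V) := by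
  classical
  have hL : 1 ≤ L := NeZero.one_le
  set N : Fin (d + 1) → ℕ := fun μ => n * M μ with hNdef
  have hR'L : IsBlockUnion L R' := isBlockUnion_fine hR'
  have himg : R'.image (blk L) = boxDom N := by rw [hbox]; exact image_blk_fineBox M
  have hRF : R' = fineBox N L := by rw [hbox]; exact boxDom_eq_fineBox M
  set V' : (Fin (d + 1) → ℤ) → ℝ := fun Y => if h : Y ∈ R'.image (blk L) then V ⟨Y, h⟩ else 0 with hV'def
  have hV' : ∀ b : ↥(R'.image (blk L)), V' b.1 = V b := fun b => by rw [hV'def]; simp only [b.2, dite_true]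
  set φ : ↥R' → ℝ := fun x' => lift N L V' x'.1 with hφdef
  have hφ : ∀ b, ∑ x' ∈ Finset.univ.filter (fun x' => rblk L R' x' = b), φ x' = (L : ℝ) ^ (d + 1) * V b := by
    intro b
    rw [filter_rblk_eq_image hL hR'L b, Finset.sum_image fun j _ j' _ h => rchart_injective hL hR'L b h]
    have hb : b.1 ∈ boxDom N := by rw [← himg]; exact b.2
    rw [← hV' b, ← sum_lift_block hL V' hb]
    rfl
  have hC : (1 : ℝ) ≤ 3 * (37 / 30 : ℝ) ^ d := by
    have : (1 : ℝ) ≤ (37 / 30 : ℝ) ^ d := one_le_pow₀ (by norm_num)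
    linarith
  have hfine : ∑ x' : ↥R', ∑ y' : ↥R', (if y'.1 ∈ nbrs x'.1 then (φ x' - φ y') ^ 2 else (0 : ℝ)) =
      2 * ∑ ν : Fin (d + 1), ∑ x ∈ (fineBox N L).filter (fun x => x + uvec ν ∈ fineBox N L),
        (lift N L V' (x + uvec ν) - lift N L V' x) ^ 2 := by
    rw [← nbr_sq_sum_eq, ← hRF]
    rw [Finset.sum_coe_sort R' (fun x => ∑ y' : ↥R', (if y'.1 ∈ nbrs x then (lift N L V' x - φ y') ^ 2 else (0 : ℝ)))]
    exact Finset.sum_congr rfl fun x _ => Finset.sum_coe_sort R' (fun y => if y ∈ nbrs x then (lift N L V' x - lift N L V' y) ^ 2 else 0)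
  have hcoarse : ∑ x : ↥(R'.image (blk L)), ∑ y : ↥(R'.image (blk L)), (if y.1 ∈ nbrs x.1 then (V x - V y) ^ 2 else (0 : ℝ)) =
      2 * ∑ ν : Fin (d + 1), ∑ Y ∈ (boxDom N).filter (fun Y => Y + uvec ν ∈ boxDom N), (V' Y - V' (Y + uvec ν)) ^ 2 := by
    have h1 : ∑ x : ↥(R'.image (blk L)), ∑ y : ↥(R'.image (blk L)), (if y.1 ∈ nbrs x.1 then (V x - V y) ^ 2 else (0 : ℝ)) =
        ∑ x ∈ R'.image (blk L), ∑ y ∈ R'.image (blk L), (if y ∈ nbrs x then (V' x - V' y) ^ 2 else (0 : ℝ)) := by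
      simp_rw [← hV']
      rw [Finset.sum_coe_sort (R'.image (blk L))
        (fun x => ∑ y : ↥(R'.image (blk L)), (if y.1 ∈ nbrs x then (V' x - V' y.1) ^ 2 else (0 : ℝ)))]
      exact Finset.sum_congr rfl fun x _ =>
        Finset.sum_coe_sort (R'.image (blk L)) (fun y => if y ∈ nbrs x then (V' x - V' y) ^ 2 else 0)
    rw [h1, himg, nbr_sq_sum_eq]
    congr 1
    exact Finset.sum_congr rfl fun ν _ => Finset.sum_congr rfl fun Y _ => by ring
  have hdir : (L : ℝ) ^ 2 * ∑ x' : ↥R', ∑ y' : ↥R', (if y'.1 ∈ nbrs x'.1 then (φ x' - φ y') ^ 2 else (0 : ℝ)) ≤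
      3 * (37 / 30 : ℝ) ^ d * (L : ℝ) ^ (d + 1) * ∑ x : ↥(R'.image (blk L)), ∑ y : ↥(R'.image (blk L)),
        (if y.1 ∈ nbrs x.1 then (V x - V y) ^ 2 else (0 : ℝ)) := by
    rw [hfine, hcoarse]
    calc (L : ℝ) ^ 2 * (2 * ∑ ν : Fin (d + 1), ∑ x ∈ (fineBox N L).filter (fun x => x + uvec ν ∈ fineBox N L),
          (lift N L V' (x + uvec ν) - lift N L V' x) ^ 2)
        = ∑ ν : Fin (d + 1), 2 * ((L : ℝ) ^ 2 * ∑ x ∈ (fineBox N L).filter (fun x => x + uvec ν ∈ fineBox N L),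
          (lift N L V' (x + uvec ν) - lift N L V' x) ^ 2) := by
          rw [Finset.mul_sum, Finset.mul_sum]; exact Finset.sum_congr rfl fun ν _ => by ring
      _ ≤ ∑ ν : Fin (d + 1), 2 * (3 * (37 / 30 : ℝ) ^ d * (L : ℝ) ^ (d + 1) *
          ∑ Y ∈ (boxDom N).filter (fun Y => Y + uvec ν ∈ boxDom N), (V' Y - V' (Y + uvec ν)) ^ 2) :=
          Finset.sum_le_sum fun ν _ => mul_le_mul_of_nonneg_left (energy_dir_le_gram hL ν V') (by norm_num)
      _ = 3 * (37 / 30 : ℝ) ^ d * (L : ℝ) ^ (d + 1) * (2 * ∑ ν : Fin (d + 1),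
          ∑ Y ∈ (boxDom N).filter (fun Y => Y + uvec ν ∈ boxDom N), (V' Y - V' (Y + uvec ν)) ^ 2) := by
          rw [Finset.mul_sum, Finset.mul_sum]; exact Finset.sum_congr rfl fun ν _ => by ring
  exact schurB_form_le_of_dirichlet hn hR' ha V φ hφ hC hdir

/-- **THE ∂_s (LIPSCHITZ) LETTER WITH THE GRAM CONSTANT**: on boxes, for all `s, t ∈ [0,1]`, every `g` and every `L`,
`‖(G(s) − G(t))g‖² ≤ (t−s)²·((3·(37∕30)^d − 1)∕min(2,a))²·‖g‖²`. [folklore] -/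
theorem twoCutoff_inv_lipschitz_gram (hn : 1 ≤ n) (M : Fin (d + 1) → ℕ) {R' : Finset (Fin (d + 1) → ℤ)}
    (hbox : R' = boxDom fun μ => n * L * M μ) (hR' : IsBlockUnion (n * L) R') {a : ℝ} (ha : 0 < a)
    {s t : ℝ} (hs0 : 0 ≤ s) (hs1 : s ≤ 1) (ht0 : 0 ≤ t) (ht1 : t ≤ 1) (g : ↥(R'.image (blk L)) → ℝ) :
    ((twoCutoffLine (isBlockUnion_fine hR') n a s)⁻¹ - (twoCutoffLine (isBlockUnion_fine hR') n a t)⁻¹).mulVec g ⬝ᵥ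
        ((twoCutoffLine (isBlockUnion_fine hR') n a s)⁻¹ - (twoCutoffLine (isBlockUnion_fine hR') n a t)⁻¹).mulVec g ≤
      (t - s) ^ 2 * ((3 * (37 / 30 : ℝ) ^ d - 1) / min 2 a) ^ 2 * (g ⬝ᵥ g) := by
  have hL : 1 ≤ L := NeZero.one_le
  have hR'L : IsBlockUnion L R' := isBlockUnion_fine hR'
  have hRc : IsBlockUnion n (R'.image (blk L)) := isBlockUnion_coarse hL hR'
  have hmin : 0 < min 2 a := lt_min (by norm_num) ha
  have hC1 : (1 : ℝ) ≤ (37 / 30 : ℝ) ^ d := one_le_pow₀ (by norm_num)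
  have hKpos : (0 : ℝ) < 3 * (37 / 30 : ℝ) ^ d - 1 := by linarith
  set H := runB hR'L n a with hH
  have hP₀ : ∀ v, min 2 a * (v ⬝ᵥ v) ≤ v ⬝ᵥ (runA n L a R').mulVec v := fun v => lower18_zero hn ha.le hRc v
  have hP₀nn : ∀ v, 0 ≤ v ⬝ᵥ (runA n L a R').mulVec v := fun v =>
    le_trans (mul_nonneg hmin.le ((Finset.sum_nonneg fun i _ => mul_self_nonneg (v i)))) (hP₀ v)
  have hlow' : ∀ v, 1 * (v ⬝ᵥ (runA n L a R').mulVec v) ≤ v ⬝ᵥ (twoCutoffLine hR'L n a 1).mulVec v := fun v => by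
    rw [one_mul]; exact runA_form_le_schurB_sharp hn hR' ha v
  have hup' : ∀ v, v ⬝ᵥ (twoCutoffLine hR'L n a 1).mulVec v ≤ 3 * (37 / 30 : ℝ) ^ d * (v ⬝ᵥ (runA n L a R').mulVec v) :=
    fun v => schurB_form_le_gram hn M hbox hR' ha v
  simp only [twoCutoffLine_one] at hlow' hup'
  have hP₁ : ∀ v, min 2 a * (v ⬝ᵥ v) ≤
      v ⬝ᵥ (H.toBlocks₁₁ - H.toBlocks₁₂ * (H.toBlocks₂₂)⁻¹ * H.toBlocks₂₁).mulVec v := by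
    intro v
    have h1 := hlow' v
    rw [one_mul] at h1
    exact (hP₀ v).trans h1
  have hup : ∀ v, v ⬝ᵥ (H.toBlocks₁₁ - H.toBlocks₁₂ * (H.toBlocks₂₂)⁻¹ * H.toBlocks₂₁).mulVec v -
      v ⬝ᵥ (runA n L a R').mulVec v ≤ (3 * (37 / 30 : ℝ) ^ d - 1) * (v ⬝ᵥ (runA n L a R').mulVec v) := by
    intro v
    have h1 := hup' v
    linarith
  have hlo : ∀ v, v ⬝ᵥ (runA n L a R').mulVec v -
      v ⬝ᵥ (H.toBlocks₁₁ - H.toBlocks₁₂ * (H.toBlocks₂₂)⁻¹ * H.toBlocks₂₁).mulVec v ≤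
      (3 * (37 / 30 : ℝ) ^ d - 1) * (v ⬝ᵥ (runA n L a R').mulVec v) := by
    intro v
    have h1 := hlow' v; have h2 := hP₀nn v
    rw [one_mul] at h1
    nlinarith [mul_nonneg hKpos.le h2]
  have main := lineOpR_inv_sub_inv_rel (runA n L a R') H.toBlocks₁₁ H.toBlocks₁₂ H.toBlocks₂₁ H.toBlocks₂₂
    (fineOpR_isSymm n a 0 _) (schurB_isSymm hR'L n a) hmin one_pos le_rfl hKpos hP₀ hP₁ hlow' hup hlo hs0 hs1 ht0 ht1 g
  rw [one_mul] at main
  exact main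

end Assembly


end Summit.QuantumFields.BalabanUV.T4Continuum.NE7K1LinHomGramUpper
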